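import Mathlib
import HarnessLib
import Literature.MathematicalPhysics.QuantumLattice.GaugeGroups
import Literature.LinearAlgebra.Matrix.UnitaryGroupMaximalTorus
import Literature.LinearAlgebra.Matrix.SpecialUnitaryGroupConjugacyClasses
import Summits.Ventures.LatticeQCDFlow.Exactness.FlowPushforward
import Summits.Ventures.LatticeQCDFlow.Exactness.TorusCircleChart
import Summits.Ventures.LatticeQCDFlow.Exactness.TorusWeylSymmetry
import Summits.Ventures.LatticeQCDFlow.Exactness.SU2TorusAlcoveJacobian
import Summits.Ventures.LatticeQCDFlow.Exactness.StickBreakingFinTwo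
import Summits.Ventures.LatticeQCDFlow.Exactness.AlcoveAffineChartSU3
import Summits.Ventures.LatticeQCDFlow.Exactness.SU3TorusChamberDecomposition

/-!
# `hfJ` for `N = 3`: the torus Jacobian of a Weyl-equivariant `SU(3)` eigen-phase flow given on the alcove — the box / simplex / alcove flow of the engine's `N = 3` spectral kernel is an exact transport of `Haar_{SΔ(3)}`

HONEST FRAMING: exact (Metropolis-corrected) sampling algorithms for lattice gauge theory;
figures of merit are autocorrelation/cost numbers at stated couplings and volumes; no
continuum-physics claim.

Venture `LatticeQCDFlow` (cell pub-lqcd), topic `Exactness`; FANOUT row 10 (`eng-equiv`, engine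
`latflow.equiv` `spectral.py` / `flows_jax.spectral_jax`, `N = 3`, `cell = 'simplex'`: box flow `χ`
on `(0,1)²` → stick-breaking `φ` onto the open simplex → Boyda's affine `ζ` onto the alcove
`A = {x₁ < x₂ < x₃ < x₁ + 2π}` in free eigen-phases → `uncanonicalise`; Boyda et al., PRD 103 (2021)
074504 §III.C eqs. (21)–(24), App. B).  NEW WORK of the cell assembling this row's
`SU3TorusChamberDecomposition.lean` (step 2b: `Haar_{SΔ(3)}` by Weyl chambers),
`TorusWeylSymmetry.lean` (`hasJacobian_of_symmetric_pieces'`), `SU2TorusAlcoveJacobian.lean`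
(`hasJacobian_of_presentation_ae`), `AlcoveAffineChartSU3.lean` (step 3b) and
`StickBreakingFinTwo.lean` (step 3a).  Nothing is cited as a fact; no number; no definition
(`E`, `P σ` through the characterising hypotheses `hE`, `hP`).  With this file the hypothesis
`hfJ` of `hasJacobian_spectralKernel_specialUnitaryGroup_of_weylFact` is DISCHARGED for `N = 3`
for every eigenvalue map given on the alcove by a flow with a Jacobian.

## What is typed (`A = {θ | θ₀ < θ₁ < −θ₀−θ₁ < θ₀ + 2π}`, `Δ° = {0 < ρ₀, 0 < ρ₁, ρ₀ + ρ₁ < 1}`,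
`ζ(ρ) = (−4π/3 + (2π/3)ρ₀ + (4π/3)ρ₁, 2π/3 − (4π/3)ρ₀ − (2π/3)ρ₁)`)

* **`hasJacobian_su3Torus_of_alcoveMap`** — `hfJ` FOR `N = 3`: let `G` have
  `HasJacobian (Leb|_A) G JA`; let `fT : SΔ(3) → SΔ(3)` and `Jf` be measurable, Weyl-equivariant
  resp. Weyl-invariant (`fT ∘ P σ = P σ ∘ fT`, `Jf ∘ P σ = Jf`), with `fT (E θ) = E (G θ)` and
  `Jf (E θ) = JA θ` on `A`.  Then `HasJacobian (Haar SΔ(3)) fT Jf`;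
* `image_alcoveAffine_su3` — `ζ(Δ°) = A` (the affine chart lands exactly on the alcove);
  **`hasJacobian_alcove_of_simplexFlow_su3'`** — simplex flows become alcove flows on `A` with the
  same Jacobian; **`hasJacobian_alcove_of_boxFlow_su3`** — box flows on `(0,1)²` (any sequence of
  box coupling layers, `BoxCouplingFlowJacobian.lean`) become alcove flows on `A` with the booked
  Jacobian `(1 − (χa)₀)·Jχ(a)/(1 − a₀)` read through `φ` and `ζ`.

NOT here: the kernel / coupling-layer statements (`SU3SpectralCouplingLayerUnconditional.lean`);
`N ≥ 4`; any number.
-/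

noncomputable section

namespace Summit.Ventures.LatticeQCDFlow.Exactness

open MeasureTheory Matrix Set Real
open Literature.LinearAlgebra.Matrix
open Literature.MathematicalPhysics.QuantumFieldTheory (haarProbability)
open scoped ENNReal

/-! ## The alcove in free eigen-phases -/

/-- The alcove `A = {θ₀ < θ₁ < −θ₀−θ₁ < θ₀ + 2π}` is measurable. -/
theorem measurableSet_alcove_su3 :
    MeasurableSet {θ : Fin 2 → ℝ | θ 0 < θ 1 ∧ θ 1 < -(θ 0 + θ 1) ∧ -(θ 0 + θ 1) < θ 0 + 2 * π} := by
  have h0 : Measurable fun θ : Fin 2 → ℝ => θ 0 := measurable_pi_apply 0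
  have h1 : Measurable fun θ : Fin 2 → ℝ => θ 1 := measurable_pi_apply 1
  exact (measurableSet_lt h0 h1).inter
    ((measurableSet_lt h1 (h0.add h1).neg).inter (measurableSet_lt (h0.add h1).neg (h0.add_const _)))

/-- The alcove is the chamber of the identity permutation. -/
theorem alcove_su3_eq_chamber_one :
    {θ : Fin 2 → ℝ | (![θ 0, θ 1, -(θ 0 + θ 1)] : Fin 3 → ℝ) ((1 : Equiv.Perm (Fin 3)) 0) <
        (![θ 0, θ 1, -(θ 0 + θ 1)] : Fin 3 → ℝ) ((1 : Equiv.Perm (Fin 3)) 1) ∧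
      (![θ 0, θ 1, -(θ 0 + θ 1)] : Fin 3 → ℝ) ((1 : Equiv.Perm (Fin 3)) 1) <
        (![θ 0, θ 1, -(θ 0 + θ 1)] : Fin 3 → ℝ) ((1 : Equiv.Perm (Fin 3)) 2) ∧
      (![θ 0, θ 1, -(θ 0 + θ 1)] : Fin 3 → ℝ) ((1 : Equiv.Perm (Fin 3)) 2) <
        (![θ 0, θ 1, -(θ 0 + θ 1)] : Fin 3 → ℝ) ((1 : Equiv.Perm (Fin 3)) 0) + 2 * π} =
    {θ : Fin 2 → ℝ | θ 0 < θ 1 ∧ θ 1 < -(θ 0 + θ 1) ∧ -(θ 0 + θ 1) < θ 0 + 2 * π} := by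
  ext θ
  simp

/-- **The affine chart lands exactly on the alcove**: `ζ(Δ°) = A`. -/
theorem image_alcoveAffine_su3 :
    (fun r : Fin 2 → ℝ =>
      (![-(4 * π / 3) + 2 * π / 3 * r 0 + 4 * π / 3 * r 1, 2 * π / 3 - 4 * π / 3 * r 0 - 2 * π / 3 * r 1] :
        Fin 2 → ℝ)) '' {ρ : Fin 2 → ℝ | 0 < ρ 0 ∧ 0 < ρ 1 ∧ ρ 0 + ρ 1 < 1} =
      {θ : Fin 2 → ℝ | θ 0 < θ 1 ∧ θ 1 < -(θ 0 + θ 1) ∧ -(θ 0 + θ 1) < θ 0 + 2 * π} := by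
  have hπ : 0 < π := pi_pos
  ext θ
  simp only [Set.mem_image, Set.mem_setOf_eq]
  constructor
  · rintro ⟨ρ, ⟨h0, h1, h2⟩, rfl⟩
    simp only [Matrix.cons_val_zero, Matrix.cons_val_one]
    refine ⟨?_, ?_, ?_⟩ <;> nlinarith
  · rintro ⟨ha, hb, hc⟩
    refine ⟨![-(θ 0 + 2 * θ 1) / (2 * π), (2 * θ 0 + θ 1) / (2 * π) + 1], ⟨?_, ?_, ?_⟩, ?_⟩
    · simp only [Matrix.cons_val_zero]
      exact div_pos (by linarith) (by positivity)
    · simp only [Matrix.cons_val_one, Matrix.cons_val_zero]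
      have h : -1 < (2 * θ 0 + θ 1) / (2 * π) := by
        rw [lt_div_iff₀ (by positivity)]
        linarith
      linarith
    · simp only [Matrix.cons_val_zero, Matrix.cons_val_one]
      have h : -(θ 0 + 2 * θ 1) / (2 * π) + (2 * θ 0 + θ 1) / (2 * π) = (θ 0 - θ 1) / (2 * π) := by ring
      have h' : (θ 0 - θ 1) / (2 * π) < 0 := div_neg_of_neg_of_pos (by linarith) (by positivity)
      linarith
    · funext i
      fin_cases i
      · simp only [Matrix.cons_val_zero, Matrix.cons_val_one, Fin.zero_eta]
        field_simp
        ring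
      · simp only [Matrix.cons_val_zero, Matrix.cons_val_one, Fin.mk_one]
        field_simp
        ring

/-- **Simplex flows become alcove flows on `A` with the same Jacobian** (`AlcoveAffineChartSU3`
restated on the alcove `A = ζ(Δ°)` written out). -/
theorem hasJacobian_alcove_of_simplexFlow_su3' {G' : (Fin 2 → ℝ) → (Fin 2 → ℝ)} {J' : (Fin 2 → ℝ) → ℝ≥0∞}
    (hG' : HasJacobian (volume.restrict {ρ : Fin 2 → ℝ | 0 < ρ 0 ∧ 0 < ρ 1 ∧ ρ 0 + ρ 1 < 1}) G' J')
    {G : (Fin 2 → ℝ) → (Fin 2 → ℝ)} (hG : Measurable G) {J : (Fin 2 → ℝ) → ℝ≥0∞} (hJ : Measurable J)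
    (hcomm : ∀ᵐ ρ ∂(volume.restrict {ρ : Fin 2 → ℝ | 0 < ρ 0 ∧ 0 < ρ 1 ∧ ρ 0 + ρ 1 < 1}),
      G (![-(4 * π / 3) + 2 * π / 3 * ρ 0 + 4 * π / 3 * ρ 1, 2 * π / 3 - 4 * π / 3 * ρ 0 - 2 * π / 3 * ρ 1]) =
        ![-(4 * π / 3) + 2 * π / 3 * (G' ρ) 0 + 4 * π / 3 * (G' ρ) 1,
          2 * π / 3 - 4 * π / 3 * (G' ρ) 0 - 2 * π / 3 * (G' ρ) 1])
    (hJ' : ∀ᵐ ρ ∂(volume.restrict {ρ : Fin 2 → ℝ | 0 < ρ 0 ∧ 0 < ρ 1 ∧ ρ 0 + ρ 1 < 1}),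
      J (![-(4 * π / 3) + 2 * π / 3 * ρ 0 + 4 * π / 3 * ρ 1, 2 * π / 3 - 4 * π / 3 * ρ 0 - 2 * π / 3 * ρ 1]) = J' ρ) :
    HasJacobian (volume.restrict {θ : Fin 2 → ℝ | θ 0 < θ 1 ∧ θ 1 < -(θ 0 + θ 1) ∧ -(θ 0 + θ 1) < θ 0 + 2 * π})
      G J := by
  rw [← image_alcoveAffine_su3]
  exact hasJacobian_alcove_of_simplexFlow_su3 hG' hG hJ hcomm hJ'

/-- **Box flows become alcove flows on `A`** (steps 3a + 3b): a box flow `χ` on `(0,1)²` with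
`HasJacobian (Leb|_{(0,1)²}) χ Jχ` (e.g. any sequence of box coupling layers), a simplex map `G'`
intertwined with `χ` through the stick-breaking chart with the booked density, and an alcove map `G`
intertwined with `G'` through `ζ`, give `HasJacobian (Leb|_A) G J`. -/
theorem hasJacobian_alcove_of_boxFlow_su3 {χ : (Fin 2 → ℝ) → (Fin 2 → ℝ)} {Jχ : (Fin 2 → ℝ) → ℝ≥0∞}
    (hχ : HasJacobian (volume.restrict (Set.pi univ fun _ : Fin 2 => Ioo (0 : ℝ) 1)) χ Jχ)
    {G' : (Fin 2 → ℝ) → (Fin 2 → ℝ)} (hG'm : Measurable G') {J' : (Fin 2 → ℝ) → ℝ≥0∞} (hJ'm : Measurable J')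
    (hcomm' : ∀ᵐ a ∂(volume.restrict (Set.pi univ fun _ : Fin 2 => Ioo (0 : ℝ) 1)),
      G' (![a 0, a 1 * (1 - a 0)]) = ![(χ a) 0, (χ a) 1 * (1 - (χ a) 0)])
    (hJχ : ∀ᵐ a ∂(volume.restrict (Set.pi univ fun _ : Fin 2 => Ioo (0 : ℝ) 1)),
      J' (![a 0, a 1 * (1 - a 0)]) = ENNReal.ofReal |1 - (χ a) 0| * Jχ a / ENNReal.ofReal |1 - a 0|)
    {G : (Fin 2 → ℝ) → (Fin 2 → ℝ)} (hG : Measurable G) {J : (Fin 2 → ℝ) → ℝ≥0∞} (hJ : Measurable J)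
    (hcomm : ∀ᵐ ρ ∂(volume.restrict {ρ : Fin 2 → ℝ | 0 < ρ 0 ∧ 0 < ρ 1 ∧ ρ 0 + ρ 1 < 1}),
      G (![-(4 * π / 3) + 2 * π / 3 * ρ 0 + 4 * π / 3 * ρ 1, 2 * π / 3 - 4 * π / 3 * ρ 0 - 2 * π / 3 * ρ 1]) =
        ![-(4 * π / 3) + 2 * π / 3 * (G' ρ) 0 + 4 * π / 3 * (G' ρ) 1,
          2 * π / 3 - 4 * π / 3 * (G' ρ) 0 - 2 * π / 3 * (G' ρ) 1])
    (hJ' : ∀ᵐ ρ ∂(volume.restrict {ρ : Fin 2 → ℝ | 0 < ρ 0 ∧ 0 < ρ 1 ∧ ρ 0 + ρ 1 < 1}),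
      J (![-(4 * π / 3) + 2 * π / 3 * ρ 0 + 4 * π / 3 * ρ 1, 2 * π / 3 - 4 * π / 3 * ρ 0 - 2 * π / 3 * ρ 1]) = J' ρ) :
    HasJacobian (volume.restrict {θ : Fin 2 → ℝ | θ 0 < θ 1 ∧ θ 1 < -(θ 0 + θ 1) ∧ -(θ 0 + θ 1) < θ 0 + 2 * π})
      G J :=
  hasJacobian_alcove_of_simplexFlow_su3' (hasJacobian_simplex_of_boxFlow_two hχ hG'm hJ'm hcomm' hJχ) hG hJ
    hcomm hJ'

/-! ## `hfJ` for `N = 3` -/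

section Torus

variable {E : (Fin 2 → ℝ) → specialDiagonalTorus (Fin 3)}
  (hE : ∀ θ (i : Fin 3), (((E θ : specialDiagonalTorus (Fin 3)) : Matrix.specialUnitaryGroup (Fin 3) ℂ) :
    Matrix (Fin 3) (Fin 3) ℂ) i i = (Circle.exp ((![θ 0, θ 1, -(θ 0 + θ 1)] : Fin 3 → ℝ) i) : ℂ))
  {P : Equiv.Perm (Fin 3) → specialDiagonalTorus (Fin 3) → specialDiagonalTorus (Fin 3)}
  (hP : ∀ σ t i,
    (((P σ t : specialDiagonalTorus (Fin 3)) : Matrix.specialUnitaryGroup (Fin 3) ℂ) : Matrix (Fin 3) (Fin 3) ℂ) i i =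
      ((t : Matrix.specialUnitaryGroup (Fin 3) ℂ) : Matrix (Fin 3) (Fin 3) ℂ) (σ i) (σ i))

include hE hP

/-- **`hfJ` for `N = 3`: the torus Jacobian of a Weyl-equivariant `SU(3)` eigen-phase flow given on
the alcove.**  Let `G` be an alcove flow with `HasJacobian (Leb|_A) G JA`
(`A = {θ₀ < θ₁ < −θ₀−θ₁ < θ₀ + 2π}` in free eigen-phases; e.g. `hasJacobian_alcove_of_boxFlow_su3`).
Let `fT : SΔ(3) → SΔ(3)` and `Jf` be measurable, with `fT (E θ) = E (G θ)` and `Jf (E θ) = JA θ`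
for `θ ∈ A`, `fT` commuting with the six phase permutations and `Jf` invariant under them
(`canonicalise` / `uncanonicalise`).  Then `HasJacobian (Haar SΔ(3)) fT Jf` — by the chamber
decomposition `Haar_{SΔ(3)} = Σ_σ (P σ)_* ((2π)⁻² E_* Leb|_A)` and transport along `E`. -/
theorem hasJacobian_su3Torus_of_alcoveMap {G : (Fin 2 → ℝ) → (Fin 2 → ℝ)} {JA : (Fin 2 → ℝ) → ℝ≥0∞}
    (hG : HasJacobian ((volume : Measure (Fin 2 → ℝ)).restrict
      {θ : Fin 2 → ℝ | θ 0 < θ 1 ∧ θ 1 < -(θ 0 + θ 1) ∧ -(θ 0 + θ 1) < θ 0 + 2 * π}) G JA)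
    {fT : specialDiagonalTorus (Fin 3) → specialDiagonalTorus (Fin 3)} (hfTm : Measurable fT)
    {Jf : specialDiagonalTorus (Fin 3) → ℝ≥0∞} (hJfm : Measurable Jf)
    (hcomm : ∀ θ : Fin 2 → ℝ, θ 0 < θ 1 → θ 1 < -(θ 0 + θ 1) → -(θ 0 + θ 1) < θ 0 + 2 * π →
      fT (E θ) = E (G θ))
    (hJA : ∀ θ : Fin 2 → ℝ, θ 0 < θ 1 → θ 1 < -(θ 0 + θ 1) → -(θ 0 + θ 1) < θ 0 + 2 * π →
      Jf (E θ) = JA θ)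
    (hequiv : ∀ σ t, fT (P σ t) = P σ (fT t)) (hJinv : ∀ σ t, Jf (P σ t) = Jf t) :
    HasJacobian (haarProbability (specialDiagonalTorus (Fin 3))) fT Jf := by
  haveI : SecondCountableTopology (specialDiagonalTorus (Fin 3)) := secondCountableTopology_specialDiagonalTorus
  have hEm : Measurable E := (continuous_measurable_angleChart_su3 hE).2
  have hPm : ∀ σ, Measurable (P σ) := fun σ => (permDiag_surjective_continuous (hP σ)).2.measurable
  -- the chamber decomposition of Haar, alcove written out
  have hdecomp : haarProbability (specialDiagonalTorus (Fin 3)) =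
      ∑ σ : Equiv.Perm (Fin 3), Measure.map (P σ) (((ENNReal.ofReal (2 * π)) ^ 2)⁻¹ •
        Measure.map E ((volume : Measure (Fin 2 → ℝ)).restrict
          {θ : Fin 2 → ℝ | θ 0 < θ 1 ∧ θ 1 < -(θ 0 + θ 1) ∧ -(θ 0 + θ 1) < θ 0 + 2 * π})) := by
    have h := haarProbability_su3Torus_eq_sum_chambers hE hP
      (C := fun τ : Equiv.Perm (Fin 3) => {θ : Fin 2 → ℝ |
        (![θ 0, θ 1, -(θ 0 + θ 1)] : Fin 3 → ℝ) (τ 0) < (![θ 0, θ 1, -(θ 0 + θ 1)] : Fin 3 → ℝ) (τ 1) ∧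
          (![θ 0, θ 1, -(θ 0 + θ 1)] : Fin 3 → ℝ) (τ 1) < (![θ 0, θ 1, -(θ 0 + θ 1)] : Fin 3 → ℝ) (τ 2) ∧
            (![θ 0, θ 1, -(θ 0 + θ 1)] : Fin 3 → ℝ) (τ 2) < (![θ 0, θ 1, -(θ 0 + θ 1)] : Fin 3 → ℝ) (τ 0) + 2 * π})
      (fun _ _ => Iff.rfl)
    rw [alcove_su3_eq_chamber_one] at h
    exact h
  -- transport of the alcove flow along the chart
  have hae : ∀ {Q : (Fin 2 → ℝ) → Prop},
      (∀ θ : Fin 2 → ℝ, θ 0 < θ 1 → θ 1 < -(θ 0 + θ 1) → -(θ 0 + θ 1) < θ 0 + 2 * π → Q θ) →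
        ∀ᵐ θ ∂(((ENNReal.ofReal (2 * π)) ^ 2)⁻¹ • (volume : Measure (Fin 2 → ℝ)).restrict
          {θ : Fin 2 → ℝ | θ 0 < θ 1 ∧ θ 1 < -(θ 0 + θ 1) ∧ -(θ 0 + θ 1) < θ 0 + 2 * π}), Q θ :=
    fun h => Measure.ae_smul_measure ((ae_restrict_iff' measurableSet_alcove_su3).mpr
      (Filter.Eventually.of_forall fun θ hθ => h θ hθ.1 hθ.2.1 hθ.2.2)) _
  have hν : HasJacobian (((ENNReal.ofReal (2 * π)) ^ 2)⁻¹ • Measure.map E ((volume : Measure (Fin 2 → ℝ)).restrict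
      {θ : Fin 2 → ℝ | θ 0 < θ 1 ∧ θ 1 < -(θ 0 + θ 1) ∧ -(θ 0 + θ 1) < θ 0 + 2 * π})) fT Jf :=
    hasJacobian_of_presentation_ae hEm (Measure.map_smul _ _ _) (hG.smul_measure _) hfTm hJfm (hae hcomm) (hae hJA)
  exact hasJacobian_of_symmetric_pieces' hPm hdecomp hfTm hJfm hν hequiv hJinv

end Torus

end Summit.Ventures.LatticeQCDFlow.Exactness
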